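import Literature.MathematicalPhysics.QuantumFieldTheory.Balaban1983to89.T4PatternLayer
import Literature.MathematicalPhysics.QuantumFieldTheory.Balaban1983to89.T4SiblingInsertion

/-!
# T⁴ programme, node U5b/U5.E, cell input NE7c — THE SIBLING-LESS (FIXED-POLARITY) SLOT PRODUCER at the `TermRepr` level:
# window floor ⇒ `TowerBound c⁻¹` ⇒ `SiblingSuppression … (fun _ ↦ c⁻¹)`, FITTED BY NAME into `T4PatternLayer.cauchy_of_finest_layer₂`
# at its fixed-block binders `hfixA` / `hfixB` (the (η) design's COUNT × SUPPRESSION member P2; cell `pub-balaban`, estimate row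
# T4-U5b.E2 (η member) / record `t4/T4-EST-NE7c-P2.md` §20, lineage t4-ne7c-p2; version tag v1 (2026-08-19); LOW LEAF: imports
# `T4PatternLayer` v1 and `T4SiblingInsertion` v1.3 only; ADDITIVE — no existing module is modified)

HONEST FRAMING.  This module is KERNEL BOOKKEEPING (one product identity, Bochner-integral monotonicity and linearity, a finite
count) for the cell's η-design.  It proves NO estimate of [Balaban1988RG2] / [Balaban1989LargeFieldI] / [Balaban1989LargeFieldII],
quotes NO sentence of Bałaban's series, carries NO cite tag and asserts nothing printed: every declaration is a statement about the
tree's own typed objects (`T4LipschitzLedger.TermRepr`/`sibW`/`sibAt`/`facAt`/`Pol.shell`, `T4LipschitzCutoff.sibling`/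
`SiblingSuppression`/`lipWeight`, `T4SiblingInsertion.SmallFieldFloor`/`UniformSmallFieldFloor`/`integral_mul_le_inv_floor`/`TowerBound`/
`siblingSuppression_of_towerBound'`/`siblingSuppression_add`, `T4AgeZeroLayer.FlipClosed`, `T4PatternLayer.fixW`/`fixSibW`/
`termRepr_fixed_window`/`cauchy_of_finest_layer₂`) and is tagged [folklore].  The small-field FLOOR that drives it is NOT produced
here: it is the named hypothesis `TermFloor` (an ESTIMATE shape, NOT PRINTED as such), asserted by nobody in this module.
NOT summit progress; rung (B)+1 bookkeeping on one four-torus; NOT infinite volume, NOT a mass gap, NOT the Clay problem.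

## What the producer is (cell bookkeeping; the socket between a floor hypothesis and the node's fixed-block binder)

`T4PatternLayer` prices the PATTERNED (flip-closed) slots of a layered term by conservation (`S ≡ 2`, a reindexing identity, no
estimate) and carries the FIXED-polarity block's sibling suppression `S_f` as the binders `hfixA` / `hfixB` of
`cauchy_of_finest_layer₂`, stated at the OLDER level on the family `termRepr_fixed_window` (weights `fixW`, window sibling weights
`fixSibW = sibW …`).  A fixed-polarity slot has no flipped twin; its sibling weight is priced instead by a one-sided SMALL-FIELD FLOOR
on the fibre `(K, t, τ, i)` of a represented family (`T4LipschitzLedger.TermRepr`): `T4SiblingInsertion.SmallFieldFloor (μ K τ) p g c`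
with factor `p = facAt_i ∈ [0, 1]` (the slot's own profile factor) and rest `g = sibling_i · RX ≥ 0` (the term's integrand with that
factor removed) — «the floored factor keeps the fraction `c` of the rest's mass».  Through the kernel-ratio step
`T4SiblingInsertion.integral_mul_le_inv_floor` with test function `ψ =` the factor's shell (`Pol.shell ≤ 1`) this gives, with NO
further input:
  per factor  `∫ sibAt_i · RX dμ ≤ c⁻¹ · X K t τ`                       (§2 `integral_sibAt_mul_le_of_floor`; `facAt_i · sibling_i = ∏ facAt`
                                                                          is §1 `mul_sibling_eq_prod`, and `∫ (∏ facAt) · RX = X` is `TermRepr.repr`)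
  per term    `sibW_σ(τ) ≤ #{i : slot i = σ} · c⁻¹ · X K t τ`            (§2 `sibW_le_card_mul_of_floor`), `≤ c⁻¹ · X K t τ` with ONE factor
              per slot (§2 `OnePerSlot` = `FlipClosed.inj` stated alone; `sibW_le_of_floor`)
  summed      `TowerBound c⁻¹ (Σ_τ X) (Σ_τ sibW_σ)`                       (§3 `towerBound_sibW_of_floor`)
              `SiblingSuppression l₀ T X N n (sibW …) (fun _ ↦ c⁻¹)`      (§3 `siblingSuppression_inv_of_floor`; with a slot-multiplicity
              cap `e`: `MultPerSlot`, `siblingSuppression_mul_inv_of_floor`, `S ≡ e · c⁻¹`)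
  by class    on a slot class `P` only (§4 `sibWOn`, `siblingSuppression_on_of_floor`) and MIXED with a patterned part `S_p` carried as a
              HYPOTHESIS: `S = S_p + c⁻¹` (§4 `siblingSuppression_add_of_floor`, `T4SiblingInsertion.siblingSuppression_add`)
  THE FIT     (§6) `T4PatternLayer`'s binder `SiblingSuppression l₀ T₀ (fixW …) N₀ n (fixSibW …) S_f` INHABITED with `S_f ≡ c⁻¹` by
              `siblingSuppression_inv_of_floor (termRepr_fixed_window …)` (`siblingSuppression_fixSibW_of_floor`; types meet BY NAME,
              `fixSibW` is `sibW` of that family by `rfl`), and `cauchy_of_finest_layer₂` RE-DERIVED VERBATIM with its three fixed-block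
              binders `hfixA`, `hfixB`, `hSf` replaced by one factor per FIXED slot (`OnePerSlot T₀ (fixM md m₀) (fixSlot md slot₀)`,
              implied by injectivity of `slot₀ K τ'` on all declared positions, §6 `onePerSlot_fix_of_inj`) and the floor in run A
              (cutoff `K`) and run B (cutoff `K + 1`): `cauchy_of_finest_layer₂_of_floor(')`, budget
              `W K + Σ_{a ≤ N₀} n a · lipWeight Lχ (2 + c⁻¹) ρ a K < 1`.
The floor hypothesis `TermFloor l₀ T χ μ m slot pol θ uX RX P c` (§3) IS `T4SiblingInsertion.UniformSmallFieldFloor` over the fibre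
index `(K, t, τ, i)` of the floored factors (`termFloor_iff_uniform`); candidate producers on the tree are the one-variable Chebyshev
floors `T4SmallFieldFloorCount` / `T4SmallFieldFloorMoment` (degenerate instance, one floored factor) — their hypotheses are
estimates owed by the seat that instantiates the represented family; nothing of that is asserted here.

What this module does NOT decide (left as binders or as the caller's data, exactly as in `T4PatternLayer`): WHICH declared factors
are fixed (the instantiation's census), whether `slot₀` is injective on the fixed block or only capped in multiplicity (both shapes
are served), the floor ratio `c` and its producer, node U5b's ledger `hsw`, the older `RelWeightBound`, the rates `ρ`, `δ`, `W`.
In particular it INSTANTIATES NOTHING: no species of slot letters, no count of fixed factors, no floor producer is applied — it is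
the generic supplier of the binder at the generality of `T4PatternLayer` itself (the cell's bookkeeping rule «nothing instantiated
until the instantiation's census declares fixed window factors» is respected; with an empty fixed block the binder is already
discharged by `T4PatternLayer.cauchy_of_finest_patterned` and this module is not needed).
-/

noncomputable section

open MeasureTheory Finset
open scoped NNReal ENNReal

namespace Literature.MathematicalPhysics.QuantumFieldTheory.Balaban1983to89.T4SiblinglessFloor

open T4LipschitzLedger T4IndicatorShell T4LipschitzCutoff T4SiblingInsertion T4AgeZeroLayer

/-! ## §1 Pointwise: the factor times its sibling is the full product; the sibling is measurable -/

/-- `p_i · sibling_i = ∏_{j<n} p_j` for `i < n` (`T4LipschitzCutoff.sibling` is the product with factor `i` removed). [folklore] -/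
theorem mul_sibling_eq_prod (p : ℕ → ℝ) {n i : ℕ} (hi : i < n) : p i * sibling p n i = ∏ j ∈ range n, p j := by
  unfold sibling
  rw [← prod_range_mul_prod_Ico p hi.le, prod_eq_prod_Ico_succ_bot hi]
  ring

/-- the sibling of a profile slot family is a measurable function of the point, for measurable tested variables. [folklore] -/
theorem measurable_sibling_facAt {Ω₀ : Type*} [MeasurableSpace Ω₀] {χ : ℕ → ℝ → ℝ} {κ Lχ : ℕ → ℝ} {sl : ℕ → Σ _ : ℕ, ℕ}
    {pol : ℕ → Pol} {θ : ℕ → ℝ} {UA : ℕ → Ω₀ → ℝ} {m : ℕ} (hχ : ∀ a, LipProfile (χ a) (κ a) (Lχ a))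
    (hA : ∀ i < m, Measurable (UA i)) {i : ℕ} (hi : i < m) :
    Measurable fun v => sibling (facAt χ sl pol θ (fun j => UA j v)) m i := by
  unfold sibling
  refine (Finset.measurable_prod _ fun j hj => ?_).mul (Finset.measurable_prod _ fun j hj => ?_)
  · exact measurable_facAt hχ (hA j ((mem_range.1 hj).trans hi))
  · exact measurable_facAt hχ (hA j (mem_Ico.1 hj).2)

/-! ## §2 Per factor: floor ⇒ `∫ sibAt_i · RX ≤ c⁻¹ · X K t τ` -/

variable {ι : Type*} {Ω : ℕ → ι → Type*} [∀ K τ, MeasurableSpace (Ω K τ)]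
variable {l₀ : ℝ} {T : ℕ → Finset ι} {X : ℕ → ℝ → ι → ℝ} {χ : ℕ → ℝ → ℝ} {κ Lχ : ℕ → ℝ} {N : ℕ} {n : ℕ → ℕ}
  {μ : (K : ℕ) → (τ : ι) → Measure (Ω K τ)} {m : ℕ → ι → ℕ} {slot : ℕ → ι → ℕ → Σ _ : ℕ, ℕ}
  {pol : ℕ → ι → ℕ → Pol} {θ : ℕ → ι → ℕ → ℝ} {uX uY : (K : ℕ) → (τ : ι) → ℕ → Ω K τ → ℝ}
  {RX : (K : ℕ) → ℝ → (τ : ι) → Ω K τ → ℝ} {ρ : ℕ → ℝ}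

/-- **PER FACTOR.**  For a represented run, a term `τ ∈ T K` at `|t| ≤ l₀` and a factor `i < m K τ` whose profile value has the
small-field floor `c > 0` against the rest of the integrand (`sibling_i · RX`): the factor's shell-restricted sibling weight is at
most `c⁻¹ ×` the term, at ANY relative width `w` — `sibAt_i · RX = shell_i · (sibling_i · RX)`, `shell_i ≤ 1`,
`integral_mul_le_inv_floor`, and `facAt_i · sibling_i · RX = (∏_j facAt_j) · RX` integrates to `X K t τ` (`TermRepr.repr`).
[folklore] -/
theorem integral_sibAt_mul_le_of_floor (h : TermRepr l₀ T X χ κ Lχ N n μ m slot pol θ uX uY RX) {K : ℕ} {t : ℝ}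
    (ht : |t| ≤ l₀) {τ : ι} (hτ : τ ∈ T K) {i : ℕ} (hi : i < m K τ) {c : ℝ} (hc : 0 < c)
    (hfl : SmallFieldFloor (μ K τ) (fun v => facAt χ (slot K τ) (pol K τ) (θ K τ) (fun j => uX K τ j v) i)
      (fun v => sibling (facAt χ (slot K τ) (pol K τ) (θ K τ) (fun j => uX K τ j v)) (m K τ) i * RX K t τ v) c)
    (w : ℝ) :
    ∫ v, sibAt χ κ (slot K τ) (pol K τ) (θ K τ) (fun j => uX K τ j v) w (m K τ) i * RX K t τ v ∂(μ K τ) ≤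
      c⁻¹ * X K t τ := by
  have hsib0 : ∀ v, 0 ≤ sibling (facAt χ (slot K τ) (pol K τ) (θ K τ) (fun j => uX K τ j v)) (m K τ) i := fun v =>
    sibling_nonneg (fun j _ => facAt_nonneg h.profile j) hi
  have hgm : Measurable fun v => sibling (facAt χ (slot K τ) (pol K τ) (θ K τ) (fun j => uX K τ j v)) (m K τ) i :=
    measurable_sibling_facAt h.profile (fun j hj => (h.meas K τ hτ j hj).1) hi
  have hgi : Integrable (fun v => sibling (facAt χ (slot K τ) (pol K τ) (θ K τ) (fun j => uX K τ j v)) (m K τ) i *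
      RX K t τ v) (μ K τ) :=
    integrable_unitInterval_mul (h.rem_int K t ht τ hτ) hgm hsib0 fun v => sibling_le_one h.profile i
  have hg0 : 0 ≤ᵐ[μ K τ] fun v => sibling (facAt χ (slot K τ) (pol K τ) (θ K τ) (fun j => uX K τ j v)) (m K τ) i *
      RX K t τ v := by
    filter_upwards [h.rem_nonneg K t ht τ hτ] with v hv
    exact mul_nonneg (hsib0 v) hv
  have hψ1 : ∀ᵐ v ∂(μ K τ), (pol K τ i).shell (uX K τ i v) (θ K τ i) (κ (slot K τ i).1) (w * θ K τ i) ≤ 1 :=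
    ae_of_all _ fun v => Pol.shell_le_one _ _ _ _ _
  have hψg_eq : (fun v => sibAt χ κ (slot K τ) (pol K τ) (θ K τ) (fun j => uX K τ j v) w (m K τ) i * RX K t τ v) =
      fun v => (pol K τ i).shell (uX K τ i v) (θ K τ i) (κ (slot K τ i).1) (w * θ K τ i) *
        (sibling (facAt χ (slot K τ) (pol K τ) (θ K τ) (fun j => uX K τ j v)) (m K τ) i * RX K t τ v) := by
    funext v
    simp only [sibAt]
    ring
  have hψgi : Integrable (fun v => (pol K τ i).shell (uX K τ i v) (θ K τ i) (κ (slot K τ i).1) (w * θ K τ i) *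
      (sibling (facAt χ (slot K τ) (pol K τ) (θ K τ) (fun j => uX K τ j v)) (m K τ) i * RX K t τ v)) (μ K τ) := by
    rw [← hψg_eq]
    exact h.integrable_sib ht hτ hi w
  have hpg_eq : (fun v => facAt χ (slot K τ) (pol K τ) (θ K τ) (fun j => uX K τ j v) i *
      (sibling (facAt χ (slot K τ) (pol K τ) (θ K τ) (fun j => uX K τ j v)) (m K τ) i * RX K t τ v)) =
      fun v => (∏ j ∈ range (m K τ), facAt χ (slot K τ) (pol K τ) (θ K τ) (fun j => uX K τ j v) j) * RX K t τ v := by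
    funext v
    rw [← mul_assoc, mul_sibling_eq_prod (facAt χ (slot K τ) (pol K τ) (θ K τ) (fun j => uX K τ j v)) hi]
  rw [hψg_eq]
  calc ∫ v, (pol K τ i).shell (uX K τ i v) (θ K τ i) (κ (slot K τ i).1) (w * θ K τ i) *
          (sibling (facAt χ (slot K τ) (pol K τ) (θ K τ) (fun j => uX K τ j v)) (m K τ) i * RX K t τ v) ∂(μ K τ)
      ≤ c⁻¹ * ∫ v, facAt χ (slot K τ) (pol K τ) (θ K τ) (fun j => uX K τ j v) i *
          (sibling (facAt χ (slot K τ) (pol K τ) (θ K τ) (fun j => uX K τ j v)) (m K τ) i * RX K t τ v) ∂(μ K τ) :=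
        integral_mul_le_inv_floor hc hfl hψ1 hg0 hψgi hgi
    _ = c⁻¹ * X K t τ := by rw [hpg_eq, ← h.repr K t ht τ hτ]

/-! ## §3 Per term: `sibW_σ(τ) ≤ (multiplicity of σ in τ) · c⁻¹ · X`, and `≤ c⁻¹ · X` with one factor per slot -/

/-- **PER TERM, WITH MULTIPLICITY.**  If every factor of `τ` sitting in slot `σ` has the floor `c`, then the slot's realized
sibling weight in `τ` is at most (the number of factors of `τ` in slot `σ`) `× c⁻¹ × X K t τ`. [folklore] -/
theorem sibW_le_card_mul_of_floor (h : TermRepr l₀ T X χ κ Lχ N n μ m slot pol θ uX uY RX) {K : ℕ} {t : ℝ}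
    (ht : |t| ≤ l₀) {τ : ι} (hτ : τ ∈ T K) {σ : Σ _ : ℕ, ℕ} {c : ℝ} (hc : 0 < c)
    (hfl : ∀ i < m K τ, slot K τ i = σ →
      SmallFieldFloor (μ K τ) (fun v => facAt χ (slot K τ) (pol K τ) (θ K τ) (fun j => uX K τ j v) i)
        (fun v => sibling (facAt χ (slot K τ) (pol K τ) (θ K τ) (fun j => uX K τ j v)) (m K τ) i * RX K t τ v) c) :
    sibW χ κ μ m slot pol θ uX RX ρ σ K t τ ≤
      ((range (m K τ)).filter (fun i => slot K τ i = σ)).card * (c⁻¹ * X K t τ) := by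
  unfold sibW
  refine (sum_le_card_nsmul _ _ (c⁻¹ * X K t τ) fun i hi => ?_).trans_eq (nsmul_eq_mul _ _)
  obtain ⟨hi, hiσ⟩ := mem_filter.1 hi
  exact integral_sibAt_mul_le_of_floor h ht hτ (mem_range.1 hi) hc (hfl i (mem_range.1 hi) hiσ) _

/-- ONE FACTOR PER SLOT (cell bookkeeping; the owner's `T4AgeZeroLayer.FlipClosed.inj`, stated alone): no term has two factors in
the same slot. [folklore] -/
def OnePerSlot (T : ℕ → Finset ι) (m : ℕ → ι → ℕ) (slot : ℕ → ι → ℕ → Σ _ : ℕ, ℕ) : Prop :=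
  ∀ K, ∀ τ ∈ T K, ∀ j < m K τ, ∀ j' < m K τ, slot K τ j = slot K τ j' → j = j'

omit [∀ K τ, MeasurableSpace (Ω K τ)] in
/-- a flip-closed bookkeeping has one factor per slot (field (v)). [folklore] -/
theorem onePerSlot_of_flipClosed {Ω' : ℕ → Type*} [∀ K, MeasurableSpace (Ω' K)] {u : (K : ℕ) → ι → ℕ → Ω' K → ℝ}
    {φ : ℕ → (Σ _ : ℕ, ℕ) → ι → ι} (hφ : FlipClosed T m slot pol θ u φ) : OnePerSlot T m slot :=
  hφ.inj

omit [∀ K τ, MeasurableSpace (Ω K τ)] in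
/-- with one factor per slot, at most one factor of a term sits in a given slot. [folklore] -/
theorem card_filter_slot_le_one (hinj : OnePerSlot T m slot) {K : ℕ} {τ : ι} (hτ : τ ∈ T K) (σ : Σ _ : ℕ, ℕ) :
    ((range (m K τ)).filter (fun i => slot K τ i = σ)).card ≤ 1 := by
  refine Finset.card_le_one.2 fun j hj j' hj' => ?_
  obtain ⟨hj, hjσ⟩ := mem_filter.1 hj
  obtain ⟨hj', hj'σ⟩ := mem_filter.1 hj'
  exact hinj K τ hτ j (mem_range.1 hj) j' (mem_range.1 hj') (hjσ.trans hj'σ.symm)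

/-- **PER TERM.**  With one factor per slot and the floor `c` for the factor of `τ` in slot `σ` (if any):
`sibW_σ(τ) ≤ c⁻¹ · X K t τ` — the sibling-less companion of `T4AgeZeroLayer.sibW_le_add_flip`. [folklore] -/
theorem sibW_le_of_floor (h : TermRepr l₀ T X χ κ Lχ N n μ m slot pol θ uX uY RX) (hinj : OnePerSlot T m slot) {K : ℕ}
    {t : ℝ} (ht : |t| ≤ l₀) {τ : ι} (hτ : τ ∈ T K) {σ : Σ _ : ℕ, ℕ} {c : ℝ} (hc : 0 < c)
    (hfl : ∀ i < m K τ, slot K τ i = σ →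
      SmallFieldFloor (μ K τ) (fun v => facAt χ (slot K τ) (pol K τ) (θ K τ) (fun j => uX K τ j v) i)
        (fun v => sibling (facAt χ (slot K τ) (pol K τ) (θ K τ) (fun j => uX K τ j v)) (m K τ) i * RX K t τ v) c) :
    sibW χ κ μ m slot pol θ uX RX ρ σ K t τ ≤ c⁻¹ * X K t τ := by
  refine (sibW_le_card_mul_of_floor h ht hτ hc hfl).trans ?_
  have hX : 0 ≤ c⁻¹ * X K t τ := mul_nonneg (inv_nonneg.2 hc.le) (termRepr_nonneg h K t ht τ hτ)
  have hcard : (((range (m K τ)).filter (fun i => slot K τ i = σ)).card : ℝ) ≤ 1 := by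
    exact_mod_cast card_filter_slot_le_one hinj hτ σ
  calc (((range (m K τ)).filter (fun i => slot K τ i = σ)).card : ℝ) * (c⁻¹ * X K t τ) ≤ 1 * (c⁻¹ * X K t τ) :=
      mul_le_mul_of_nonneg_right hcard hX
    _ = c⁻¹ * X K t τ := one_mul _

/-! ## §4 The named binder (W-Y) at the `TermRepr` level and the summed forms -/

/-- **(W-Y) AT THE `TermRepr` LEVEL** (hypothesis shape, NOT PRINTED; the referee's window floor of R-σ-3 (c) read on represented
runs): ONE constant `c > 0` such that every represented factor whose slot lies in the floored class `P` — every `K`, `|t| ≤ l₀`,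
`τ ∈ T K`, `i < m K τ` with `P (slot K τ i)` — has the small-field floor `c` of its profile value against the rest of the term's
integrand (its sibling times the remainder).  `P` = the sibling-less ∕ fixed-polarity slots (`fun _ ↦ True`: all slots). [folklore] -/
def TermFloor (l₀ : ℝ) (T : ℕ → Finset ι) (χ : ℕ → ℝ → ℝ) (μ : (K : ℕ) → (τ : ι) → Measure (Ω K τ)) (m : ℕ → ι → ℕ)
    (slot : ℕ → ι → ℕ → Σ _ : ℕ, ℕ) (pol : ℕ → ι → ℕ → Pol) (θ : ℕ → ι → ℕ → ℝ)
    (uX : (K : ℕ) → (τ : ι) → ℕ → Ω K τ → ℝ) (RX : (K : ℕ) → ℝ → (τ : ι) → Ω K τ → ℝ) (P : (Σ _ : ℕ, ℕ) → Prop)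
    (c : ℝ) : Prop :=
  0 < c ∧ ∀ K t, |t| ≤ l₀ → ∀ τ ∈ T K, ∀ i < m K τ, P (slot K τ i) →
    SmallFieldFloor (μ K τ) (fun v => facAt χ (slot K τ) (pol K τ) (θ K τ) (fun j => uX K τ j v) i)
      (fun v => sibling (facAt χ (slot K τ) (pol K τ) (θ K τ) (fun j => uX K τ j v)) (m K τ) i * RX K t τ v) c

/-- the binder is antitone in the floored class. [folklore] -/
theorem TermFloor.mono {P Q : (Σ _ : ℕ, ℕ) → Prop} {c : ℝ} (h : TermFloor l₀ T χ μ m slot pol θ uX RX P c)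
    (hQP : ∀ σ, Q σ → P σ) : TermFloor l₀ T χ μ m slot pol θ uX RX Q c :=
  ⟨h.1, fun K t ht τ hτ i hi hQ => h.2 K t ht τ hτ i hi (hQP _ hQ)⟩

/-- THE FIBRE INDEX of the represented floored factors: `(K, t, τ, i)` with `|t| ≤ l₀`, `τ ∈ T K`, `i < m K τ`, `P (slot K τ i)`.
[folklore] -/
def Fibre (l₀ : ℝ) (T : ℕ → Finset ι) (m : ℕ → ι → ℕ) (slot : ℕ → ι → ℕ → Σ _ : ℕ, ℕ) (P : (Σ _ : ℕ, ℕ) → Prop) : Type _ :=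
  {q : ℕ × ℝ × ι × ℕ // |q.2.1| ≤ l₀ ∧ q.2.2.1 ∈ T q.1 ∧ q.2.2.2 < m q.1 q.2.2.1 ∧ P (slot q.1 q.2.2.1 q.2.2.2)}


/-- **`TermFloor` IS `T4SiblingInsertion.UniformSmallFieldFloor`** over the fibre index of the represented floored factors (the
referee's «`UniformSmallFieldFloor` with fibre index J = (K, t, k, history, X_i, b, x)», read with τ = (k, history, X_i), i ↦ b,
the exterior integrated in `μ K τ`). [folklore] -/
theorem termFloor_iff_uniform {P : (Σ _ : ℕ, ℕ) → Prop} {c : ℝ} :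
    TermFloor l₀ T χ μ m slot pol θ uX RX P c ↔
      UniformSmallFieldFloor (J := Fibre l₀ T m slot P) (Ω₀ := fun q => Ω q.1.1 q.1.2.2.1)
        (fun q => μ q.1.1 q.1.2.2.1)
        (fun q v => facAt χ (slot q.1.1 q.1.2.2.1) (pol q.1.1 q.1.2.2.1) (θ q.1.1 q.1.2.2.1)
          (fun j => uX q.1.1 q.1.2.2.1 j v) q.1.2.2.2)
        (fun q v => sibling (facAt χ (slot q.1.1 q.1.2.2.1) (pol q.1.1 q.1.2.2.1) (θ q.1.1 q.1.2.2.1)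
          (fun j => uX q.1.1 q.1.2.2.1 j v)) (m q.1.1 q.1.2.2.1) q.1.2.2.2 * RX q.1.1 q.1.2.1 q.1.2.2.1 v) c := by
  constructor
  · rintro ⟨hc, h⟩
    exact ⟨hc, fun q => h q.1.1 q.1.2.1 q.2.1 q.1.2.2.1 q.2.2.1 q.1.2.2.2 q.2.2.2.1 q.2.2.2.2⟩
  · rintro ⟨hc, h⟩
    exact ⟨hc, fun K t ht τ hτ i hi hP => h ⟨(K, t, τ, i), ht, hτ, hi, hP⟩⟩

/-- **SUMMED, PER FLOORED SLOT: the `TowerBound c⁻¹` datum** — what `T4SiblingInsertion.siblingSuppression_of_towerBound'` and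
the `hTA`/`hTB` of `shellWeightBound_of_towerBound_add_levels` consume. [folklore] -/
theorem towerBound_sibW_of_floor (h : TermRepr l₀ T X χ κ Lχ N n μ m slot pol θ uX uY RX) (hinj : OnePerSlot T m slot)
    {P : (Σ _ : ℕ, ℕ) → Prop} {c : ℝ} (hfl : TermFloor l₀ T χ μ m slot pol θ uX RX P c) {σ : Σ _ : ℕ, ℕ} (hσ : P σ)
    (K : ℕ) (t : ℝ) (ht : |t| ≤ l₀) :
    TowerBound c⁻¹ (∑ τ ∈ T K, X K t τ) (∑ τ ∈ T K, sibW χ κ μ m slot pol θ uX RX ρ σ K t τ) := by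
  rw [towerBound_iff_le, mul_sum]
  refine sum_le_sum fun τ hτ => sibW_le_of_floor h hinj ht hτ hfl.1 fun i hi hiσ => hfl.2 K t ht τ hτ i hi ?_
  rw [hiσ]
  exact hσ

/-- **ALL SLOTS FLOORED ⇒ `SiblingSuppression … (fun _ ↦ c⁻¹)`** — the sibling-less companion of
`T4AgeZeroLayer.siblingSuppression_two_of_flip`. [folklore] -/
theorem siblingSuppression_inv_of_floor (h : TermRepr l₀ T X χ κ Lχ N n μ m slot pol θ uX uY RX)
    (hinj : OnePerSlot T m slot) {c : ℝ} (hfl : TermFloor l₀ T χ μ m slot pol θ uX RX (fun _ => True) c) :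
    SiblingSuppression l₀ T X N n (sibW χ κ μ m slot pol θ uX RX ρ) (fun _ => c⁻¹) :=
  siblingSuppression_of_towerBound' fun _ _ K t ht => towerBound_sibW_of_floor h hinj hfl trivial K t ht

/-- AT MOST `e` FACTORS PER SLOT (cell bookkeeping; the multiplicity-capped variant of `OnePerSlot`, for typings whose slot map
does not separate the windows of one age by the copy index). [folklore] -/
def MultPerSlot (T : ℕ → Finset ι) (m : ℕ → ι → ℕ) (slot : ℕ → ι → ℕ → Σ _ : ℕ, ℕ) (e : ℕ) : Prop :=
  ∀ K, ∀ τ ∈ T K, ∀ σ : (Σ _ : ℕ, ℕ), ((range (m K τ)).filter (fun i => slot K τ i = σ)).card ≤ e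

omit [∀ K τ, MeasurableSpace (Ω K τ)] in
/-- one factor per slot is multiplicity `≤ 1`. [folklore] -/
theorem multPerSlot_one_of_onePerSlot (hinj : OnePerSlot T m slot) : MultPerSlot T m slot 1 := fun _ _ hτ σ =>
  card_filter_slot_le_one hinj hτ σ

/-- **ALL SLOTS FLOORED, MULTIPLICITY `≤ e` ⇒ `SiblingSuppression … (fun _ ↦ e · c⁻¹)`.** [folklore] -/
theorem siblingSuppression_mul_inv_of_floor (h : TermRepr l₀ T X χ κ Lχ N n μ m slot pol θ uX uY RX) {e : ℕ}
    (he : MultPerSlot T m slot e) {c : ℝ} (hfl : TermFloor l₀ T χ μ m slot pol θ uX RX (fun _ => True) c) :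
    SiblingSuppression l₀ T X N n (sibW χ κ μ m slot pol θ uX RX ρ) (fun _ => (e : ℝ) * c⁻¹) := by
  intro σ _ K t ht
  show _ ≤ (e : ℝ) * c⁻¹ * ∑ τ ∈ T K, X K t τ
  rw [mul_sum]
  refine sum_le_sum fun τ hτ => ?_
  refine (sibW_le_card_mul_of_floor (ρ := ρ) h ht hτ hfl.1 fun i hi _ => hfl.2 K t ht τ hτ i hi trivial).trans ?_
  have hX : 0 ≤ c⁻¹ * X K t τ := mul_nonneg (inv_nonneg.2 hfl.1.le) (termRepr_nonneg h K t ht τ hτ)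
  have hcard : (((range (m K τ)).filter (fun i => slot K τ i = σ)).card : ℝ) ≤ e := by exact_mod_cast he K τ hτ σ
  calc (((range (m K τ)).filter (fun i => slot K τ i = σ)).card : ℝ) * (c⁻¹ * X K t τ) ≤ (e : ℝ) * (c⁻¹ * X K t τ) :=
      mul_le_mul_of_nonneg_right hcard hX
    _ = (e : ℝ) * c⁻¹ * X K t τ := (mul_assoc _ _ _).symm

open Classical in
/-- THE RESTRICTION OF A SLOT-INDEXED WEIGHT TO A SLOT CLASS (`0` off the class). [folklore] -/
def sibWOn (P : (Σ _ : ℕ, ℕ) → Prop) (sib : (Σ _ : ℕ, ℕ) → ℕ → ℝ → ι → ℝ) (σ : Σ _ : ℕ, ℕ) (K : ℕ) (t : ℝ) (τ : ι) : ℝ :=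
  if P σ then sib σ K t τ else 0

omit [∀ K τ, MeasurableSpace (Ω K τ)] in
/-- a slot-indexed weight is the sum of its restrictions to a class and to the complement (pointwise, exactly). [folklore] -/
theorem sibWOn_add_sibWOn_not (P : (Σ _ : ℕ, ℕ) → Prop) (sib : (Σ _ : ℕ, ℕ) → ℕ → ℝ → ι → ℝ) (σ : Σ _ : ℕ, ℕ) (K : ℕ)
    (t : ℝ) (τ : ι) : sibWOn P sib σ K t τ + sibWOn (fun σ => ¬ P σ) sib σ K t τ = sib σ K t τ := by
  unfold sibWOn
  by_cases hP : P σ <;> simp [hP]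

omit [∀ K τ, MeasurableSpace (Ω K τ)] in
/-- … hence the split inequality `siblingSuppression_add` asks for (an equality). [folklore] -/
theorem sum_le_sum_sibWOn_add (P : (Σ _ : ℕ, ℕ) → Prop) (sib : (Σ _ : ℕ, ℕ) → ℕ → ℝ → ι → ℝ) (σ : Σ _ : ℕ, ℕ) (K : ℕ)
    (t : ℝ) : ∑ τ ∈ T K, sib σ K t τ ≤ ∑ τ ∈ T K, sibWOn P sib σ K t τ + ∑ τ ∈ T K, sibWOn (fun σ => ¬ P σ) sib σ K t τ := by
  rw [← sum_add_distrib]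
  exact (sum_congr rfl fun τ _ => (sibWOn_add_sibWOn_not P sib σ K t τ).symm).le

/-- **THE FLOORED CLASS ALONE ⇒ `SiblingSuppression … (sibWOn P (sibW …)) (fun _ ↦ c⁻¹)`** (off the class the restricted
weight is `0 ≤ c⁻¹ · Σ X`). [folklore] -/
theorem siblingSuppression_on_of_floor (h : TermRepr l₀ T X χ κ Lχ N n μ m slot pol θ uX uY RX)
    (hinj : OnePerSlot T m slot) {P : (Σ _ : ℕ, ℕ) → Prop} {c : ℝ} (hfl : TermFloor l₀ T χ μ m slot pol θ uX RX P c) :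
    SiblingSuppression l₀ T X N n (sibWOn P (sibW χ κ μ m slot pol θ uX RX ρ)) (fun _ => c⁻¹) := by
  intro σ _ K t ht
  show _ ≤ c⁻¹ * ∑ τ ∈ T K, X K t τ
  by_cases hσ : P σ
  · simp only [sibWOn, if_pos hσ]
    exact le_of_towerBound (towerBound_sibW_of_floor h hinj hfl hσ K t ht)
  · simp only [sibWOn, if_neg hσ, sum_const_zero]
    exact mul_nonneg (inv_nonneg.2 hfl.1.le) (sum_nonneg fun τ hτ => termRepr_nonneg h K t ht τ hτ)

/-- **MIXED: the patterned class priced by the owner (HYPOTHESIS `S_p`, e.g. `≡ 2` from flip-closure) + the floored class priced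
here ⇒ `SiblingSuppression … (sibW …) (fun a ↦ S_p a + c⁻¹)`** — `T4SiblingInsertion.siblingSuppression_add` with the exact
split `sum_le_sum_sibWOn_add`; the `S_f := fun _ ↦ c⁻¹` of the sum-form budget `lipWeight L (S_p + S_f) ρ a K`. [folklore] -/
theorem siblingSuppression_add_of_floor (h : TermRepr l₀ T X χ κ Lχ N n μ m slot pol θ uX uY RX)
    (hinj : OnePerSlot T m slot) {P : (Σ _ : ℕ, ℕ) → Prop} {c : ℝ} (hfl : TermFloor l₀ T χ μ m slot pol θ uX RX P c)
    {Sp : ℕ → ℝ} (hpat : SiblingSuppression l₀ T X N n (sibWOn (fun σ => ¬ P σ) (sibW χ κ μ m slot pol θ uX RX ρ)) Sp) :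
    SiblingSuppression l₀ T X N n (sibW χ κ μ m slot pol θ uX RX ρ) (fun a => Sp a + c⁻¹) :=
  siblingSuppression_add hpat (siblingSuppression_on_of_floor h hinj hfl) fun σ _ K t _ => by
    rw [add_comm]
    exact sum_le_sum_sibWOn_add P _ σ K t

/-! ## §5 Sanity (kernel-checked instances; nothing printed) -/

namespace Sanity

/-- the product identity on three factors at position `1`: `p₁ · (p₀ p₂) = p₀ p₁ p₂`. [folklore] -/
example (a b d : ℝ) : (fun i => if i = 0 then a else if i = 1 then b else d) 1 *
    sibling (fun i => if i = 0 then a else if i = 1 then b else d) 3 1 =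
      ∏ j ∈ range 3, (fun i => if i = 0 then a else if i = 1 then b else d) j :=
  mul_sibling_eq_prod (fun i => if i = 0 then a else if i = 1 then b else d) (n := 3) (i := 1) (by norm_num)

/-- the floor shape is inhabited at `c = 1` by the trivial factor and the kernel-ratio step then reads `∫ ψ g ≤ ∫ g`
(non-vacuity of the chain's two links on a Dirac fibre). [folklore] -/
example (g : Unit → ℝ) : SmallFieldFloor (Measure.dirac ()) (fun _ => (1 : ℝ)) g 1 := smallFieldFloor_one _ _

/-- the restriction device: on the class it is the weight, off the class it is `0`. [folklore] -/
example (sib : (Σ _ : ℕ, ℕ) → ℕ → ℝ → Unit → ℝ) :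
    sibWOn (fun σ => σ.1 = 0) sib ⟨0, 3⟩ 5 0 () = sib ⟨0, 3⟩ 5 0 () ∧ sibWOn (fun σ => σ.1 = 0) sib ⟨1, 3⟩ 5 0 () = 0 := by
  simp [sibWOn]

/-- one factor per slot holds for an injective slot map (two factors, slots `⟨0,0⟩`, `⟨0,1⟩`). [folklore] -/
example : OnePerSlot (ι := Unit) (fun _ => {()}) (fun _ _ => 2) (fun _ _ j => ⟨0, j⟩) := by
  intro K τ _ j hj j' hj' hjj'
  simpa using congrArg Sigma.snd hjj'

end Sanity

/-! ## §6 THE FIT into `T4PatternLayer` (v1): the fixed-block binders `hfixA` / `hfixB` of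
`cauchy_of_finest_layer₂` INHABITED from the window floor (W-Y) with `S_f ≡ c⁻¹`, and the owner's end-to-end theorem re-derived with
the floor in place of the binders (types meet BY NAME; nothing of the owner's restated; `fixSibW` is `sibW` of `termRepr_fixed_window`'s
family by `rfl`). The ONE datum beyond the owner's binders: one factor per slot on the FIXED block (`OnePerSlot T₀ (fixM md m₀)
(fixSlot md slot₀)`), implied by injectivity of `slot₀ K τ'` on all declared positions (`onePerSlot_fix_of_inj`, the shape of
`cauchy_of_finest_patterned`'s `hinj`); or a multiplicity cap `e` (`MultPerSlot`, `S_f ≡ e · c⁻¹`). The floor `TermFloor …` stays an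
ESTIMATE binder (NOT PRINTED as such; (W-Y) of `t4/T4-REF-U5.md` §14.5 (c), owed by the instantiating seat per R-σ-3 (c)). -/

section Fit

open T4Continuum T4LevelShift T4AveragingDisintegration T4WindowLevelShift T4FiniteEpsInhabited
  BlockAveraging ExpMeanLog T4FinestToWindow
open T4WeightBudget T4HybridMatching T4CauchySum T4PatternLayer

variable {ι₀ : Type*} {N : ℕ} [NeZero N] (F : T4Family)

/-- Bałaban's exp-mean-log small-plaquette average (0.4) on `SU(N)` (`ExpMeanLog.expMeanLogSU`). -/
local notation "EML" => (expMeanLogSU : LoopAverage (SU N))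

variable {l₀ : ℝ} {T₀ : ℕ → Finset ι₀} {χ : ℕ → ℝ → ℝ} {κ Lχ : ℕ → ℝ} {N₀ : ℕ} {n : ℕ → ℕ} {NW₀ : ι₀ → ℕ} {md m₀ : ℕ → ι₀ → ℕ}
  {slot₀ : ℕ → ι₀ → ℕ → Σ _ : ℕ, ℕ} {fpol : ℕ → ι₀ → ℕ → Pol} {θ₀ : ℕ → ι₀ → ℕ → ℝ}
  {vX vY : (K : ℕ) → (τ' : ι₀) → ℕ → GaugeField (F.P (NW₀ τ')) 0 (SU N) → ℝ}

/-- injectivity of the slot map on ALL declared positions (the shape of `cauchy_of_finest_patterned`'s `hinj`) gives one factor per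
slot on the fixed block (reindexed from `0`). [folklore] -/
theorem onePerSlot_fix_of_inj
    (hinj : ∀ K, ∀ τ' ∈ T₀ K, ∀ j < m₀ K τ', ∀ j' < m₀ K τ', slot₀ K τ' j = slot₀ K τ' j' → j = j') :
    OnePerSlot T₀ (fixM md m₀) (fixSlot md slot₀) := by
  intro K τ' hτ' j hj j' hj' h
  have hj₁ : j < m₀ K τ' - md K τ' := hj
  have hj₂ : j' < m₀ K τ' - md K τ' := hj'
  have := hinj K τ' hτ' (md K τ' + j) (by omega) (md K τ' + j') (by omega) h
  omega

/-- … and its restriction to the patterned block is the owner's `hinj`. [folklore] -/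
theorem inj_patterned_of_inj (hmd : ∀ K, ∀ τ' ∈ T₀ K, md K τ' ≤ m₀ K τ')
    (hinj : ∀ K, ∀ τ' ∈ T₀ K, ∀ j < m₀ K τ', ∀ j' < m₀ K τ', slot₀ K τ' j = slot₀ K τ' j' → j = j') :
    ∀ K, ∀ τ' ∈ T₀ K, ∀ j < md K τ', ∀ j' < md K τ', slot₀ K τ' j = slot₀ K τ' j' → j = j' :=
  fun K τ' hτ' j hj j' hj' h => hinj K τ' hτ' j (lt_of_lt_of_le hj (hmd K τ' hτ')) j' (lt_of_lt_of_le hj' (hmd K τ' hτ')) h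

/-- **THE FIT, ONE RUN** (cutoff map `KX`, window not deeper than the run): the owner's fixed-block binder
`SiblingSuppression l₀ T₀ (fixW …) N₀ n (fixSibW …) S_f` INHABITED with `S_f ≡ c⁻¹` from the window floor on the fixed block's fibres
`(K, t, τ', k)` (factor `facAt_k`, rest `sibling_k ·` old density of the older history's weight) and one factor per fixed slot —
`siblingSuppression_inv_of_floor` applied to `T4PatternLayer.termRepr_fixed_window` BY NAME. [folklore] -/
theorem siblingSuppression_fixSibW_of_floor (KX : ℕ → ℕ) (hNW : ∀ K, ∀ τ' ∈ T₀ K, NW₀ τ' ≤ KX K)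
    (hχ : ∀ a, LipProfile (χ a) (κ a) (Lχ a))
    (hθ : ∀ K, ∀ τ' ∈ T₀ K, ∀ i < m₀ K τ', 0 < θ₀ K τ' i)
    (hwin : ∀ K, ∀ τ' ∈ T₀ K, ∀ i < m₀ K τ', slot₀ K τ' i ∈ (range (N₀ + 1)).sigma fun a => range (n a))
    (hband : ∀ K, ∀ τ' ∈ T₀ K, ∀ i < m₀ K τ', (slot₀ K τ' i).1 ≤ K)
    (hv : ∀ K, ∀ τ' ∈ T₀ K, ∀ i < m₀ K τ', Measurable (vX K τ' i) ∧ Measurable (vY K τ' i))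
    {RX : (K : ℕ) → ℝ → ι₀ → GaugeField (F.P (KX K)) 0 (SU N) → ℝ}
    (hR0 : ∀ K t, |t| ≤ l₀ → ∀ τ' ∈ T₀ K, 0 ≤ᵐ[fieldMeasure (F.P (KX K)) 0 (SU N)] RX K t τ')
    (hRi : ∀ K t, |t| ≤ l₀ → ∀ τ' ∈ T₀ K, Integrable (RX K t τ') (fieldMeasure (F.P (KX K)) 0 (SU N))) {ρ : ℕ → ℝ}
    (hinjf : OnePerSlot T₀ (fixM md m₀) (fixSlot md slot₀)) {c : ℝ}
    (hfl : TermFloor l₀ T₀ χ (fun _ τ' => fieldMeasure (F.P (NW₀ τ')) 0 (SU N)) (fixM md m₀) (fixSlot md slot₀) (fixPol md fpol)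
      (fixThr md θ₀) (fixVar md vX) (fun K t τ' V => (oldDensity F EML (KX K) (NW₀ τ') (RX K t τ') V : ℝ)) (fun _ => True) c) :
    SiblingSuppression l₀ T₀ (fixW F χ NW₀ md m₀ slot₀ fpol θ₀ vX KX RX) N₀ n
      (fixSibW F χ κ NW₀ md m₀ slot₀ fpol θ₀ vX KX RX ρ) (fun _ => c⁻¹) :=
  siblingSuppression_inv_of_floor (termRepr_fixed_window F KX hNW hχ hθ hwin hband hv hR0 hRi) hinjf hfl

/-- **THE FIT, ONE RUN, WITH A MULTIPLICITY CAP** `e` on the fixed block's slot copies instead of one-per-slot: `S_f ≡ e · c⁻¹`.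
[folklore] -/
theorem siblingSuppression_fixSibW_of_floor_mult (KX : ℕ → ℕ) (hNW : ∀ K, ∀ τ' ∈ T₀ K, NW₀ τ' ≤ KX K)
    (hχ : ∀ a, LipProfile (χ a) (κ a) (Lχ a))
    (hθ : ∀ K, ∀ τ' ∈ T₀ K, ∀ i < m₀ K τ', 0 < θ₀ K τ' i)
    (hwin : ∀ K, ∀ τ' ∈ T₀ K, ∀ i < m₀ K τ', slot₀ K τ' i ∈ (range (N₀ + 1)).sigma fun a => range (n a))
    (hband : ∀ K, ∀ τ' ∈ T₀ K, ∀ i < m₀ K τ', (slot₀ K τ' i).1 ≤ K)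
    (hv : ∀ K, ∀ τ' ∈ T₀ K, ∀ i < m₀ K τ', Measurable (vX K τ' i) ∧ Measurable (vY K τ' i))
    {RX : (K : ℕ) → ℝ → ι₀ → GaugeField (F.P (KX K)) 0 (SU N) → ℝ}
    (hR0 : ∀ K t, |t| ≤ l₀ → ∀ τ' ∈ T₀ K, 0 ≤ᵐ[fieldMeasure (F.P (KX K)) 0 (SU N)] RX K t τ')
    (hRi : ∀ K t, |t| ≤ l₀ → ∀ τ' ∈ T₀ K, Integrable (RX K t τ') (fieldMeasure (F.P (KX K)) 0 (SU N))) {ρ : ℕ → ℝ} {e : ℕ}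
    (hmult : MultPerSlot T₀ (fixM md m₀) (fixSlot md slot₀) e) {c : ℝ}
    (hfl : TermFloor l₀ T₀ χ (fun _ τ' => fieldMeasure (F.P (NW₀ τ')) 0 (SU N)) (fixM md m₀) (fixSlot md slot₀) (fixPol md fpol)
      (fixThr md θ₀) (fixVar md vX) (fun K t τ' V => (oldDensity F EML (KX K) (NW₀ τ') (RX K t τ') V : ℝ)) (fun _ => True) c) :
    SiblingSuppression l₀ T₀ (fixW F χ NW₀ md m₀ slot₀ fpol θ₀ vX KX RX) N₀ n
      (fixSibW F χ κ NW₀ md m₀ slot₀ fpol θ₀ vX KX RX ρ) (fun _ => (e : ℝ) * c⁻¹) :=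
  siblingSuppression_mul_inv_of_floor (termRepr_fixed_window F KX hNW hχ hθ hwin hband hv hR0 hRi) hmult hfl

end Fit

section EndToEndFit

open T4Continuum T4LevelShift T4AveragingDisintegration T4WindowLevelShift T4FiniteEpsInhabited
  BlockAveraging ExpMeanLog T4FinestToWindow
open T4WeightBudget T4HybridMatching T4CauchySum T4PatternLayer

variable {ι₀ : Type*} [DecidableEq ι₀] {N : ℕ} [NeZero N] (F : T4Family)

/-- Bałaban's exp-mean-log small-plaquette average (0.4) on `SU(N)` (`ExpMeanLog.expMeanLogSU`). -/
local notation "EML" => (expMeanLogSU : LoopAverage (SU N))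

/-- **`cauchy_of_finest_layer₂` WITH THE FIXED BLOCK PRICED BY THE WINDOW FLOOR** — the owner's end-to-end theorem re-derived VERBATIM
with its three fixed-block binders `hfixA`, `hfixB`, `hSf` REPLACED by: one factor per fixed slot (`hinjf`) and the window floor with
ratio `c > 0` on the fixed block's fibres in run A (`hflA`, cutoff `K`) and in run B (`hflB`, cutoff `K + 1`) — `S_f ≡ c⁻¹`, budget
`W K + Σ_{a ≤ N₀} n a · lipWeight Lχ (2 + c⁻¹) ρ a K < 1`. The floors are ESTIMATES, NOT PRINTED as such (REF (W-Y)); everything else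
is the owner's binder list unchanged. This is the FIT CERTIFICATE: the (η) member's producer meets the node's socket by name. [folklore] -/
theorem cauchy_of_finest_layer₂_of_floor {l₀ vol : ℝ} {T₀ : ℕ → Finset ι₀} {Bad₀ : ℕ → ℝ → Finset ι₀} {W δ ρ : ℕ → ℝ}
    {χ : ℕ → ℝ → ℝ} {κ Lχ : ℕ → ℝ} (hχ : ∀ a, LipProfile (χ a) (κ a) (Lχ a)) {N₀ : ℕ} {n : ℕ → ℕ}
    {NW₀ : ι₀ → ℕ} (hNW : ∀ K, ∀ τ' ∈ T₀ K, NW₀ τ' ≤ K)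
    {md m₀ : ℕ → ι₀ → ℕ} (hmd : ∀ K, ∀ τ' ∈ T₀ K, md K τ' ≤ m₀ K τ')
    {slot₀ : ℕ → ι₀ → ℕ → Σ _ : ℕ, ℕ}
    (hwin : ∀ K, ∀ τ' ∈ T₀ K, ∀ i < m₀ K τ', slot₀ K τ' i ∈ (range (N₀ + 1)).sigma fun a => range (n a))
    (hband : ∀ K, ∀ τ' ∈ T₀ K, ∀ i < m₀ K τ', (slot₀ K τ' i).1 ≤ K)
    (hinj : ∀ K, ∀ τ' ∈ T₀ K, ∀ j < md K τ', ∀ j' < md K τ', slot₀ K τ' j = slot₀ K τ' j' → j = j')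
    (hinjf : OnePerSlot T₀ (fixM md m₀) (fixSlot md slot₀))
    {fpol : ℕ → ι₀ → ℕ → Pol} {θ₀ : ℕ → ι₀ → ℕ → ℝ} (hθ : ∀ K, ∀ τ' ∈ T₀ K, ∀ i < m₀ K τ', 0 < θ₀ K τ' i)
    {vA vB : (K : ℕ) → (τ' : ι₀) → ℕ → GaugeField (F.P (NW₀ τ')) 0 (SU N) → ℝ}
    (hvm : ∀ K, ∀ τ' ∈ T₀ K, ∀ i < m₀ K τ', Measurable (vA K τ' i) ∧ Measurable (vB K τ' i))
    (hvc : ∀ K, ∀ τ' ∈ T₀ K, ∀ i < m₀ K τ', ∀ᵐ V ∂fieldMeasure (F.P (NW₀ τ')) 0 (SU N),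
      |vA K τ' i V - vB K τ' i V| ≤ ρ (K - (slot₀ K τ' i).1) * θ₀ K τ' i)
    {RA : (K : ℕ) → ℝ → ι₀ → GaugeField (F.P K) 0 (SU N) → ℝ}
    {RB : (K : ℕ) → ℝ → ι₀ → GaugeField (F.P (K + 1)) 0 (SU N) → ℝ}
    (hRA0 : ∀ K t, |t| ≤ l₀ → ∀ τ' ∈ T₀ K, 0 ≤ᵐ[fieldMeasure (F.P K) 0 (SU N)] RA K t τ')
    (hRAi : ∀ K t, |t| ≤ l₀ → ∀ τ' ∈ T₀ K, Integrable (RA K t τ') (fieldMeasure (F.P K) 0 (SU N)))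
    (hRB0 : ∀ K t, |t| ≤ l₀ → ∀ τ' ∈ T₀ K, 0 ≤ᵐ[fieldMeasure (F.P (K + 1)) 0 (SU N)] RB K t τ')
    (hRBi : ∀ K t, |t| ≤ l₀ → ∀ τ' ∈ T₀ K, Integrable (RB K t τ') (fieldMeasure (F.P (K + 1)) 0 (SU N)))
    (hW : RelWeightBound l₀ T₀ (fixW F χ NW₀ md m₀ slot₀ fpol θ₀ vA (fun K => K) RA)
      (fixW F χ NW₀ md m₀ slot₀ fpol θ₀ vB (fun K => K + 1) RB) Bad₀ W)
    {c : ℝ}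
    (hflA : TermFloor l₀ T₀ χ (fun _ τ' => fieldMeasure (F.P (NW₀ τ')) 0 (SU N)) (fixM md m₀) (fixSlot md slot₀) (fixPol md fpol)
      (fixThr md θ₀) (fixVar md vA) (fun K t τ' V => (oldDensity F EML K (NW₀ τ') (RA K t τ') V : ℝ)) (fun _ => True) c)
    (hflB : TermFloor l₀ T₀ χ (fun _ τ' => fieldMeasure (F.P (NW₀ τ')) 0 (SU N)) (fixM md m₀) (fixSlot md slot₀) (fixPol md fpol)
      (fixThr md θ₀) (fixVar md vB) (fun K t τ' V => (oldDensity F EML (K + 1) (NW₀ τ') (RB K t τ') V : ℝ)) (fun _ => True) c)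
    (hvol : 0 < vol) (hl₀ : 0 ≤ l₀) (hρ0 : ∀ j, 0 ≤ ρ j) (hρ : Summable ρ)
    (hlt : ∀ K, W K + ∑ a ∈ range (N₀ + 1), (n a : ℝ) * lipWeight Lχ (fun _ => 2 + c⁻¹) ρ a K < 1) {Z : ℕ → ℝ → ℝ}
    (hZA : ∀ K t, |t| ≤ l₀ → Z K t = ∑ τ' ∈ T₀ K, fixW F χ NW₀ md m₀ slot₀ fpol θ₀ vA (fun K => K) RA K t τ')
    (hZB : ∀ K t, |t| ≤ l₀ → Z (K + 1) t = ∑ τ' ∈ T₀ K, fixW F χ NW₀ md m₀ slot₀ fpol θ₀ vB (fun K => K + 1) RB K t τ')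
    (hpos : ∀ K t, |t| ≤ l₀ → 0 < ∑ τ' ∈ T₀ K, fixW F χ NW₀ md m₀ slot₀ fpol θ₀ vA (fun K => K) RA K t τ')
    (hδ : Summable δ) {cK : ℕ → ℝ}
    (hsw : ∀ K t, |t| ≤ l₀ → ∀ τ' ∈ T₀ K \ Bad₀ K t,
      (∀ᵐ V ∂fieldMeasure (F.P (NW₀ τ')) 0 (SU N),
          Real.exp (cK K - vol * δ K) * (oldDensity F EML K (NW₀ τ') (RA K t τ') V : ℝ) ≤
            (oldDensity F EML (K + 1) (NW₀ τ') (RB K t τ') V : ℝ)) ∧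
        (∀ᵐ V ∂fieldMeasure (F.P (NW₀ τ')) 0 (SU N),
          (oldDensity F EML (K + 1) (NW₀ τ') (RB K t τ') V : ℝ) ≤
            Real.exp (cK K + vol * δ K) * (oldDensity F EML K (NW₀ τ') (RA K t τ') V : ℝ))) :
    MatchingModConstants vol l₀
        (hybridDelta vol δ fun K => W K + ∑ a ∈ range (N₀ + 1), (n a : ℝ) * lipWeight Lχ (fun _ => 2 + c⁻¹) ρ a K) Z ∧
      Summable (hybridDelta vol δ fun K => W K + ∑ a ∈ range (N₀ + 1), (n a : ℝ) * lipWeight Lχ (fun _ => 2 + c⁻¹) ρ a K) ∧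
      (∀ t : ℝ, |t| ≤ l₀ → CauchySeq fun K => genFun Z K t) ∧
      TendstoUniformlyOn (fun K t => genFun Z K t) (genFunLim Z) Filter.atTop {t | |t| ≤ l₀} :=
  cauchy_of_finest_layer₂ F (Sf := fun _ => c⁻¹) hχ hNW hmd hwin hband hinj hθ hvm hvc hRA0 hRAi hRB0 hRBi hW
    (siblingSuppression_fixSibW_of_floor F (fun K => K) hNW hχ hθ hwin hband hvm hRA0 hRAi hinjf hflA)
    (siblingSuppression_fixSibW_of_floor F (fun K => K + 1) (fun K τ' hτ' => Nat.le_succ_of_le (hNW K τ' hτ')) hχ hθ hwin hband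
      (fun K τ' hτ' i hi => (hvm K τ' hτ' i hi).symm) hRB0 hRBi hinjf hflB)
    (fun _ _ => inv_nonneg.2 hflA.1.le) hvol hl₀ hρ0 hρ hlt hZA hZB hpos hδ hsw

/-- **… with injectivity of `slot₀` on ALL declared positions** (the shape of `cauchy_of_finest_patterned`'s `hinj`) supplying both
the owner's patterned `hinj` and the fixed block's one-per-slot. [folklore] -/
theorem cauchy_of_finest_layer₂_of_floor' {l₀ vol : ℝ} {T₀ : ℕ → Finset ι₀} {Bad₀ : ℕ → ℝ → Finset ι₀} {W δ ρ : ℕ → ℝ}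
    {χ : ℕ → ℝ → ℝ} {κ Lχ : ℕ → ℝ} (hχ : ∀ a, LipProfile (χ a) (κ a) (Lχ a)) {N₀ : ℕ} {n : ℕ → ℕ}
    {NW₀ : ι₀ → ℕ} (hNW : ∀ K, ∀ τ' ∈ T₀ K, NW₀ τ' ≤ K)
    {md m₀ : ℕ → ι₀ → ℕ} (hmd : ∀ K, ∀ τ' ∈ T₀ K, md K τ' ≤ m₀ K τ')
    {slot₀ : ℕ → ι₀ → ℕ → Σ _ : ℕ, ℕ}
    (hwin : ∀ K, ∀ τ' ∈ T₀ K, ∀ i < m₀ K τ', slot₀ K τ' i ∈ (range (N₀ + 1)).sigma fun a => range (n a))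
    (hband : ∀ K, ∀ τ' ∈ T₀ K, ∀ i < m₀ K τ', (slot₀ K τ' i).1 ≤ K)
    (hinj : ∀ K, ∀ τ' ∈ T₀ K, ∀ j < m₀ K τ', ∀ j' < m₀ K τ', slot₀ K τ' j = slot₀ K τ' j' → j = j')
    {fpol : ℕ → ι₀ → ℕ → Pol} {θ₀ : ℕ → ι₀ → ℕ → ℝ} (hθ : ∀ K, ∀ τ' ∈ T₀ K, ∀ i < m₀ K τ', 0 < θ₀ K τ' i)
    {vA vB : (K : ℕ) → (τ' : ι₀) → ℕ → GaugeField (F.P (NW₀ τ')) 0 (SU N) → ℝ}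
    (hvm : ∀ K, ∀ τ' ∈ T₀ K, ∀ i < m₀ K τ', Measurable (vA K τ' i) ∧ Measurable (vB K τ' i))
    (hvc : ∀ K, ∀ τ' ∈ T₀ K, ∀ i < m₀ K τ', ∀ᵐ V ∂fieldMeasure (F.P (NW₀ τ')) 0 (SU N),
      |vA K τ' i V - vB K τ' i V| ≤ ρ (K - (slot₀ K τ' i).1) * θ₀ K τ' i)
    {RA : (K : ℕ) → ℝ → ι₀ → GaugeField (F.P K) 0 (SU N) → ℝ}
    {RB : (K : ℕ) → ℝ → ι₀ → GaugeField (F.P (K + 1)) 0 (SU N) → ℝ}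
    (hRA0 : ∀ K t, |t| ≤ l₀ → ∀ τ' ∈ T₀ K, 0 ≤ᵐ[fieldMeasure (F.P K) 0 (SU N)] RA K t τ')
    (hRAi : ∀ K t, |t| ≤ l₀ → ∀ τ' ∈ T₀ K, Integrable (RA K t τ') (fieldMeasure (F.P K) 0 (SU N)))
    (hRB0 : ∀ K t, |t| ≤ l₀ → ∀ τ' ∈ T₀ K, 0 ≤ᵐ[fieldMeasure (F.P (K + 1)) 0 (SU N)] RB K t τ')
    (hRBi : ∀ K t, |t| ≤ l₀ → ∀ τ' ∈ T₀ K, Integrable (RB K t τ') (fieldMeasure (F.P (K + 1)) 0 (SU N)))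
    (hW : RelWeightBound l₀ T₀ (fixW F χ NW₀ md m₀ slot₀ fpol θ₀ vA (fun K => K) RA)
      (fixW F χ NW₀ md m₀ slot₀ fpol θ₀ vB (fun K => K + 1) RB) Bad₀ W)
    {c : ℝ}
    (hflA : TermFloor l₀ T₀ χ (fun _ τ' => fieldMeasure (F.P (NW₀ τ')) 0 (SU N)) (fixM md m₀) (fixSlot md slot₀) (fixPol md fpol)
      (fixThr md θ₀) (fixVar md vA) (fun K t τ' V => (oldDensity F EML K (NW₀ τ') (RA K t τ') V : ℝ)) (fun _ => True) c)
    (hflB : TermFloor l₀ T₀ χ (fun _ τ' => fieldMeasure (F.P (NW₀ τ')) 0 (SU N)) (fixM md m₀) (fixSlot md slot₀) (fixPol md fpol)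
      (fixThr md θ₀) (fixVar md vB) (fun K t τ' V => (oldDensity F EML (K + 1) (NW₀ τ') (RB K t τ') V : ℝ)) (fun _ => True) c)
    (hvol : 0 < vol) (hl₀ : 0 ≤ l₀) (hρ0 : ∀ j, 0 ≤ ρ j) (hρ : Summable ρ)
    (hlt : ∀ K, W K + ∑ a ∈ range (N₀ + 1), (n a : ℝ) * lipWeight Lχ (fun _ => 2 + c⁻¹) ρ a K < 1) {Z : ℕ → ℝ → ℝ}
    (hZA : ∀ K t, |t| ≤ l₀ → Z K t = ∑ τ' ∈ T₀ K, fixW F χ NW₀ md m₀ slot₀ fpol θ₀ vA (fun K => K) RA K t τ')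
    (hZB : ∀ K t, |t| ≤ l₀ → Z (K + 1) t = ∑ τ' ∈ T₀ K, fixW F χ NW₀ md m₀ slot₀ fpol θ₀ vB (fun K => K + 1) RB K t τ')
    (hpos : ∀ K t, |t| ≤ l₀ → 0 < ∑ τ' ∈ T₀ K, fixW F χ NW₀ md m₀ slot₀ fpol θ₀ vA (fun K => K) RA K t τ')
    (hδ : Summable δ) {cK : ℕ → ℝ}
    (hsw : ∀ K t, |t| ≤ l₀ → ∀ τ' ∈ T₀ K \ Bad₀ K t,
      (∀ᵐ V ∂fieldMeasure (F.P (NW₀ τ')) 0 (SU N),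
          Real.exp (cK K - vol * δ K) * (oldDensity F EML K (NW₀ τ') (RA K t τ') V : ℝ) ≤
            (oldDensity F EML (K + 1) (NW₀ τ') (RB K t τ') V : ℝ)) ∧
        (∀ᵐ V ∂fieldMeasure (F.P (NW₀ τ')) 0 (SU N),
          (oldDensity F EML (K + 1) (NW₀ τ') (RB K t τ') V : ℝ) ≤
            Real.exp (cK K + vol * δ K) * (oldDensity F EML K (NW₀ τ') (RA K t τ') V : ℝ))) :
    MatchingModConstants vol l₀
        (hybridDelta vol δ fun K => W K + ∑ a ∈ range (N₀ + 1), (n a : ℝ) * lipWeight Lχ (fun _ => 2 + c⁻¹) ρ a K) Z ∧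
      Summable (hybridDelta vol δ fun K => W K + ∑ a ∈ range (N₀ + 1), (n a : ℝ) * lipWeight Lχ (fun _ => 2 + c⁻¹) ρ a K) ∧
      (∀ t : ℝ, |t| ≤ l₀ → CauchySeq fun K => genFun Z K t) ∧
      TendstoUniformlyOn (fun K t => genFun Z K t) (genFunLim Z) Filter.atTop {t | |t| ≤ l₀} :=
  cauchy_of_finest_layer₂_of_floor F hχ hNW hmd hwin hband (inj_patterned_of_inj hmd hinj)
    (onePerSlot_fix_of_inj hinj) hθ hvm hvc hRA0 hRAi hRB0 hRBi hW hflA hflB hvol hl₀ hρ0 hρ hlt hZA hZB hpos hδ hsw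

end EndToEndFit

end Literature.MathematicalPhysics.QuantumFieldTheory.Balaban1983to89.T4SiblinglessFloor
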